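import Mathlib
import Literature.Analysis.Complex.SeparatelyHolomorphicStrips
import HarnessLib

/-!
# Identity theorems from real points: preconnected open sets and the forward cone tube

Topic `Literature/Analysis/Complex`. Everything here is PROVED (no named facts, no definitions).

* `eqOn_of_isPreconnected_of_eq_ofReal`: two functions holomorphic on a preconnected open set
  `U ⊆ ℂ` containing a real point, equal at all real points of `U`, agree on `U` (the real points of
  `U` near a real point of `U` accumulate there). Banach-space valued and for an arbitrary
  preconnected open `U`: it strictly generalises the fixed-strip, `ℂ`-valued versions
  `eqOn_setOf_abs_im_lt_of_forall_ofReal` (`SeparatelyHolomorphicStrips`) and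
  `eqOn_strip_of_eq_ofReal` (`StripTilingEntire`); the strip lemmas `isOpen_setOf_abs_im_lt`,
  `isPreconnected_setOf_abs_im_lt` are reused from `SeparatelyHolomorphicStrips`.
* `eqOn_coneTube_of_eq_ofReal`: the two-variable identity theorem on the forward tube
  `𝒯 = {(t, y) ∈ ℂ² : |Im y| < Re t}` of the speed-one light cone, from SEPARATE holomorphy of the
  slices (`y ↦ f(t, y)` on the strip `|Im y| < t` for real `t > 0`, `t ↦ f(t, y)` on the half-plane
  `Re t > |Im y|`) and agreement at the real points `t > 0, y ∈ ℝ`: slice twice. This is the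
  uniqueness statement behind the holomorphic semigroup `e^{-tH + iyP}` of a Euclidean field theory
  with the light-cone spectral condition (Glimm–Jaffe, *Quantum Physics* (1987), §19.5).
* `DifferentiableOn.coneTube_slice_fst/snd`: joint holomorphy on `𝒯` gives the slices;
  `differentiableOn_conj_comp_conj_strip/halfPlane`: the Schwarz-reflected slices
  `conj ∘ f ∘ conj` are holomorphic too (Mathlib `differentiableAt_conj_conj_iff`), so that
  `eqOn_coneTube_of_eq_ofReal` also proves reality statements `f(p̄) = conj f(p)`.

## References
* J. Glimm, A. Jaffe, *Quantum Physics* (2nd ed. 1987), §19.5. [folklore]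
-/

noncomputable section

open Complex Set Filter Topology ComplexConjugate

namespace Literature.Analysis.Complex

variable {E : Type*} [NormedAddCommGroup E] [NormedSpace ℂ E] [CompleteSpace E]

/-- **Identity theorem from the real points of a preconnected open set.** If `f, g` are holomorphic
on a preconnected open `U ⊆ ℂ`, `U` contains a real point `x₀`, and `f t = g t` for every real `t`
with `t ∈ U`, then `f = g` on `U`. [folklore] -/
theorem eqOn_of_isPreconnected_of_eq_ofReal {U : Set ℂ} (hU : IsOpen U) (hUc : IsPreconnected U)
    {x₀ : ℝ} (hx₀ : (x₀ : ℂ) ∈ U) {f g : ℂ → E} (hf : DifferentiableOn ℂ f U)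
    (hg : DifferentiableOn ℂ g U) (h : ∀ t : ℝ, (t : ℂ) ∈ U → f t = g t) : EqOn f g U := by
  refine (hf.analyticOnNhd hU).eqOn_of_preconnected_of_frequently_eq (hg.analyticOnNhd hU) hUc hx₀ ?_
  have htend : Tendsto (fun t : ℝ => (t : ℂ)) (𝓝[≠] x₀) (𝓝[≠] (x₀ : ℂ)) :=
    continuous_ofReal.continuousWithinAt.tendsto_nhdsWithin (fun t ht => by simpa using ht)
  have hmem : ∀ᶠ t : ℝ in 𝓝 x₀, (t : ℂ) ∈ U :=
    continuous_ofReal.continuousAt.preimage_mem_nhds (hU.mem_nhds hx₀)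
  have hev : ∀ᶠ t : ℝ in 𝓝[≠] x₀, f t = g t :=
    (hmem.filter_mono nhdsWithin_le_nhds).mono fun t ht => h t ht
  exact htend.frequently hev.frequently

/-- A holomorphic function on a preconnected open set containing a real point, constant at the real
points of the set, is constant there. [folklore] -/
theorem eqOn_const_of_isPreconnected_of_eq_ofReal {U : Set ℂ} (hU : IsOpen U) (hUc : IsPreconnected U)
    {x₀ : ℝ} (hx₀ : (x₀ : ℂ) ∈ U) {f : ℂ → E} (hf : DifferentiableOn ℂ f U) {c : E}
    (h : ∀ t : ℝ, (t : ℂ) ∈ U → f t = c) : EqOn f (fun _ => c) U :=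
  eqOn_of_isPreconnected_of_eq_ofReal hU hUc hx₀ hf (differentiableOn_const c) h

/-- **Identity theorem on the forward cone tube** `{(t, y) : |Im y| < Re t}` from separate
holomorphy of the slices and agreement at the real points `t > 0`, `y ∈ ℝ`. [folklore] -/
theorem eqOn_coneTube_of_eq_ofReal {f g : ℂ × ℂ → E}
    (hf₁ : ∀ t : ℝ, 0 < t → DifferentiableOn ℂ (fun y : ℂ => f ((t : ℂ), y)) {y : ℂ | |y.im| < t})
    (hg₁ : ∀ t : ℝ, 0 < t → DifferentiableOn ℂ (fun y : ℂ => g ((t : ℂ), y)) {y : ℂ | |y.im| < t})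
    (hf₂ : ∀ y : ℂ, DifferentiableOn ℂ (fun t : ℂ => f (t, y)) {t : ℂ | |y.im| < t.re})
    (hg₂ : ∀ y : ℂ, DifferentiableOn ℂ (fun t : ℂ => g (t, y)) {t : ℂ | |y.im| < t.re})
    (h : ∀ t y : ℝ, 0 < t → f ((t : ℂ), (y : ℂ)) = g ((t : ℂ), (y : ℂ))) :
    ∀ p : ℂ × ℂ, |p.2.im| < p.1.re → f p = g p := by
  -- first slice: real `t > 0`, complex `y` in the strip
  have step1 : ∀ t : ℝ, 0 < t → ∀ y : ℂ, |y.im| < t → f ((t : ℂ), y) = g ((t : ℂ), y) := by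
    intro t ht y hy
    have h0 : ((0 : ℝ) : ℂ) ∈ {y : ℂ | |y.im| < t} := by simpa using ht
    exact eqOn_of_isPreconnected_of_eq_ofReal (isOpen_setOf_abs_im_lt t) (isPreconnected_setOf_abs_im_lt t)
      h0 (hf₁ t ht) (hg₁ t ht) (fun s _ => h t s ht) hy
  -- second slice: complex `t` in the half-plane, `y` fixed
  rintro ⟨t, y⟩ hp
  have h0 : ((|y.im| + 1 : ℝ) : ℂ) ∈ {t : ℂ | |y.im| < t.re} := by
    show |y.im| < ((|y.im| + 1 : ℝ) : ℂ).re
    rw [ofReal_re]; linarith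
  refine eqOn_of_isPreconnected_of_eq_ofReal (isOpen_lt continuous_const continuous_re)
    (convex_halfSpace_re_gt |y.im|).isPreconnected h0 (hf₂ y) (hg₂ y) (fun s hs => ?_) hp
  have hs' : |y.im| < s := by simpa using hs
  exact step1 s ((abs_nonneg _).trans_lt hs') y hs'

omit [CompleteSpace E] in
/-- Joint holomorphy on the cone tube gives holomorphic `y`-slices. [folklore] -/
theorem _root_.DifferentiableOn.coneTube_slice_snd {f : ℂ × ℂ → E}
    (hf : DifferentiableOn ℂ f {p : ℂ × ℂ | |p.2.im| < p.1.re}) (t : ℝ) :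
    DifferentiableOn ℂ (fun y : ℂ => f ((t : ℂ), y)) {y : ℂ | |y.im| < t} :=
  hf.comp ((differentiableOn_const _).prodMk differentiableOn_id) fun y hy => by simpa using hy

omit [CompleteSpace E] in
/-- Joint holomorphy on the cone tube gives holomorphic `t`-slices. [folklore] -/
theorem _root_.DifferentiableOn.coneTube_slice_fst {f : ℂ × ℂ → E}
    (hf : DifferentiableOn ℂ f {p : ℂ × ℂ | |p.2.im| < p.1.re}) (y : ℂ) :
    DifferentiableOn ℂ (fun t : ℂ => f (t, y)) {t : ℂ | |y.im| < t.re} :=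
  hf.comp (differentiableOn_id.prodMk (differentiableOn_const _)) fun t ht => by simpa using ht

/-- Schwarz reflection of a holomorphic function on a conjugation-symmetric open set:
`z ↦ conj (f (conj z))` is holomorphic there. [folklore] -/
theorem differentiableOn_conj_comp_conj {f : ℂ → ℂ} {U : Set ℂ} (hU : IsOpen U)
    (hsymm : ∀ z ∈ U, conj z ∈ U) (hf : DifferentiableOn ℂ f U) :
    DifferentiableOn ℂ (fun z => conj (f (conj z))) U := by
  intro z hz
  have hd : DifferentiableAt ℂ f (conj z) := hf.differentiableAt (hU.mem_nhds (hsymm z hz))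
  have := (differentiableAt_conj_conj_iff (f := f) (x := z)).2 hd
  exact this.differentiableWithinAt

/-- The reflected `y`-slice `y ↦ conj f(t, conj y)` is holomorphic on the strip. [folklore] -/
theorem differentiableOn_conj_comp_conj_strip {f : ℂ → ℂ} {t : ℝ}
    (hf : DifferentiableOn ℂ f {y : ℂ | |y.im| < t}) :
    DifferentiableOn ℂ (fun y => conj (f (conj y))) {y : ℂ | |y.im| < t} :=
  differentiableOn_conj_comp_conj (isOpen_setOf_abs_im_lt t) (fun z hz => by simpa using hz) hf

/-- The reflected `t`-slice `t ↦ conj f(conj t, y)` is holomorphic on the half-plane. [folklore] -/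
theorem differentiableOn_conj_comp_conj_halfPlane {f : ℂ → ℂ} {r : ℝ}
    (hf : DifferentiableOn ℂ f {t : ℂ | r < t.re}) :
    DifferentiableOn ℂ (fun t => conj (f (conj t))) {t : ℂ | r < t.re} :=
  differentiableOn_conj_comp_conj (isOpen_lt continuous_const continuous_re) (fun z hz => by simpa using hz) hf

/-- **Reality on the cone tube.** A function `G` holomorphic on the tube and REAL at the real
points `t > 0, y ∈ ℝ` satisfies `G(conj t, conj y) = conj G(t, y)` on the tube
(`eqOn_coneTube_of_eq_ofReal` applied to `G` and its Schwarz reflection). [folklore] -/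
theorem conj_apply_coneTube_of_real {G : ℂ × ℂ → ℂ}
    (hG : DifferentiableOn ℂ G {p : ℂ × ℂ | |p.2.im| < p.1.re})
    (hreal : ∀ t y : ℝ, 0 < t → (G ((t : ℂ), (y : ℂ))).im = 0) :
    ∀ p : ℂ × ℂ, |p.2.im| < p.1.re → G (conj p.1, conj p.2) = conj (G p) := by
  -- compare `G♯ p = conj G(conj p)` with `G`
  set Gs : ℂ × ℂ → ℂ := fun p => conj (G (conj p.1, conj p.2)) with hGs
  have key : ∀ p : ℂ × ℂ, |p.2.im| < p.1.re → Gs p = G p := by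
    refine eqOn_coneTube_of_eq_ofReal (f := Gs) (g := G) ?_ ?_ ?_ ?_ ?_
    · intro t ht
      have h1 := differentiableOn_conj_comp_conj_strip (hG.coneTube_slice_snd t)
      refine h1.congr fun y _ => ?_
      simp [hGs, Complex.conj_ofReal]
    · exact fun t _ => hG.coneTube_slice_snd t
    · intro y
      have h2 : {t : ℂ | |(conj y).im| < t.re} = {t : ℂ | |y.im| < t.re} := by
        ext t; simp
      have h1 := differentiableOn_conj_comp_conj_halfPlane (h2 ▸ hG.coneTube_slice_fst (conj y))
      refine h1.congr fun t _ => ?_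
      simp [hGs]
    · exact fun y => hG.coneTube_slice_fst y
    · intro t y ht
      simp only [hGs, Complex.conj_ofReal]
      exact Complex.conj_eq_iff_im.2 (hreal t y ht)
  intro p hp
  have := key p hp
  simp only [hGs] at this
  rw [← this, Complex.conj_conj]

end Literature.Analysis.Complex
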